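import Summits.QuantumFields.BalabanUV.Beta.EriceRemainderEnclosureHistoryAutonomyComparisonAgeCompositionStaticChain
import Summits.QuantumFields.BalabanUV.Beta.EriceRemainderEnclosureHistoryAutonomyComparisonAgeCompositionStaticChainHyperbolic
import Literature.MathematicalPhysics.QuantumFieldTheory.Balaban1983to89.B7Eq38Remainder

/-!
# EriceRemainderEnclosureHistoryAutonomyComparisonAgeCompositionStaticChainMoments — (E75c) THE COMPOUNDING SIDE OF THE STATIC CHAIN IS CARRIED BY SCALED MOMENTS:
# the chain load `V = Σ_i θ̄(a_i∕z)·b_i` that a young scale `z` sees is bounded by the TWO-MOMENT ENVELOPE `V ≤ 2m₁ − (6∕5)m₂`, `m_p = Σ_i b_i·(z∕a_i)^p`, because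
# **`θ̄(r) ≤ 2∕r − (6∕5)∕r²`** for every scale ratio `r ≥ 1` (a RIGOROUS quadratic envelope in `t = 1∕r`: `θ̄ ≤ 2t − (6∕5)t²`, exact at `t → 0`, `1.8 %` above
# `θ̄(1) = 0.7856` at `t = 1`); and the moments are an EXACT state of the chain: they RESCALE exactly under a change of the young scale (`m_p(z') =
# (z'∕z)^p·m_p(z)`) and UPDATE exactly when an age is added (`m_p ↦ (m_p + ρ·(z∕a)^p)∕(1 − ρ)`) — so the two-moment chain (defects `2t − (6∕5)t²`) is a closing
# majorant of the static chain in the sense of (E72a) `ratio_le_of_majorant` whenever it closes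

Cell `pub-balaban`, β-function sub-cell, BINDER row D4 «RemainderConst leaves for Bałaban's split» (`HOME/BINDER-OWNERS.md`; owner lineage `b2b-balaban-beta-an4`;
this file by co-owner #2 lineage `b2b-balaban-beta-d4-p2`, generation 66), β-FLOW TEAM duty (1), FREEZE (0) honoured (def-free; imports (E72a)
`…AgeCompositionStaticChain` and (E72c) `…StaticChainHyperbolic`; uses `ratio_le_of_majorant` (E72a), `thetabar_mem_unit_interval` (E72c), `exp_le_quartic`
(`Literature/…/Balaban1983to89/B7Eq38Remainder`) BY NAME; nothing restated).

HONEST FRAMING (page 1, verbatim and binding).  *"Discharging BetaPertH makes Bałaban's UV stability UNCONDITIONAL — a real constructive-QFT result; it is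
NOT the continuum limit and NOT the Clay problem."*  THIS FILE DISCHARGES NOTHING OF THE KIND.  Elementary real analysis (one exponential inequality) and
algebra of finite sums — hypotheses of a census, not facts; the form, signs, ages and moments of Bałaban's (1.22) limit functional are NOT PRINTED ([I] p. 298;
GAPS G-t4-U2-1∕-2) and NOT asserted.  Row D4 class UNCHANGED (critical-path width 0; instance 0∕1; D4 DISCHARGE NO DATE).  HONEST DEPENDENCY: continuum YM on
T⁴ ⇐ BetaPertH ∧ nine spine estimates (0/9 proved); BetaPertH ⇐ (D1) ∧ (D4) ∧ CAP+tail; G-an2-4 gates asym, D1 and NE2/3/4.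

THE POINT (README `HOME/b2b-balaban-beta-d4-p2/g66/e75/README.md` §3; successor design item (4)(iii)–(iv) of `g65/e74/README.md` §5).  Every station since g63
treated the chain load `V` as a functional of the whole configuration (ages and carried ratios), which is why the bin majorants of g64∕g65 had to keep the
bins `≤ 1.2` wide ACROSS THE WHOLE WINDOW.  Seen from the young scale `z`, an old age `a_i` enters `V` through `θ̄(a_i∕z) = ϑ(t_i)`, `t_i = z∕a_i ∈ ]0,1]`,
`ϑ(t) = 1 − (1+t)^{−3∕2}e^{−t∕2}`; `ϑ(t)∕t` is convex decreasing from `2` to `θ̄(1)` (numerics `g66/numerics/mom1.py`), so the CHORD `ϑ(t) ≤ 2t − (2 − θ̄(1))t²` is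
exact at both ends and `≤ 21 %` above `ϑ` in between, and cubic majorants tangent at interior points are within `1–4 %` everywhere; and the power sums
`m_p = Σ_i b_i t_i^p` are an EXACT STATE (rescaling and update, §2).  Numerics of record (kit j312978, TRUE window-mass chains over (E65a)'s lattice polytope,
families {1..16}, {2..16}, {4..32}, {8..40}, towers, mixed, and the continuum regime z = 24∕48 with all integer near ages (z, 8z] + far teeth): replacing `V` by
the two-moment envelope AT EVERY STEP (errors compounding through the carried ratios) raises `sup ρ` from 0.73–0.75 to 0.74–0.76 and `sup x·V` by ≈ 20 %;
the three-moment (cubic) envelope is within 1 % of the true chain.  This file proves the rigorous quadratic envelope with `6∕5` in place of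
`2 − θ̄(1) = 1.2144` (one-line loss: `1.8 %` at ratio 1, `0` at ratio `∞`) and the exact moment bookkeeping.  NOT CLAIMED (§1–§3): the cubic envelopes; the static closure; anything printed.  The chord constant
`2 − θ̄(1)` itself is proved in the append §4 (`thetabar_le_chord`), derivative-free.

WHAT IS PROVED ([folklore]; 0 `def`, 0 sorry).  §1 THE ENVELOPE: `inv_taylor_le_exp_neg` (from the tree's `B7Eq38Remainder.exp_le_quartic`:
`e^x ≤ 1 + x + x²∕2 + x³∕6 + 5x⁴∕96` on `[0,1]`), `inv_le_sqrt_inv` (`1∕(1+t∕2) ≤ √(1∕(1+t))`), `envelope_poly_le_one` (the degree-8 polynomial certificate: `1 − P(t) = t²·Q(t)`, `Q`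
decreasing on `[0,1]` with `Q(1) > 0`), **`psi_ge_quadratic`** (`(1+t)^{−3∕2}e^{−t∕2} ≥ 1 − 2t + (6∕5)t²` on `[0,1]`), **`thetabar_le_two_moment`** (`θ̄(r) ≤ 2∕r −
(6∕5)∕r²`, `r ≥ 1`, (E72c)'s letters).  §2 EXACT MOMENT BOOKKEEPING: **`moment_succ`** (update under (E72a)'s `hnew`∕`hold` for ANY weights), **`moment_rescale`**,
`two_moment_load_eq`.  §3 THE TWO-MOMENT MAJORANT: **`load_le_two_moment`** (`Σ_{i<m} θ̄(a_i∕a_m) b_{m,i} ≤ 2m₁ − (6∕5)m₂` for `b ≥ 0`, ages processed oldest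
first), **`closes_of_two_moment_chain_closes`** ((E72a) `ratio_le_of_majorant` with the defects `2t − (6∕5)t²`).  §4 (append) THE CHORD IS RIGOROUS:
`psi_one_bounds` (`0.2143 ≤ ψ(1) ≤ 0.2145`), `psi_ge_psi_one`, `psi_ge_chord_left` (`t ≤ 9∕10`, certificate with `Q(9∕10) = 0.254`), `psi_ge_chord_right` (`t ≥ 7∕10`, monotonicity),
**`psi_ge_chord`** (`ψ(t) ≥ (1−t)² + ψ(1)t²` on `[0,1]`), **`thetabar_le_chord`** (`θ̄(r) ≤ 2∕r − (2 − θ̄(1))∕r²`, `r ≥ 1` — the optimal two-moment envelope).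
-/
noncomputable section
open Finset

namespace Summit.QuantumFields.BalabanUV.Beta.EriceRemainderEnclosureHistoryAutonomyComparisonAgeCompositionStaticChainMoments

open Summit.QuantumFields.BalabanUV.Beta.EriceRemainderEnclosureHistoryAutonomyComparisonAgeCompositionStaticChain (ratio_le_of_majorant)
open Summit.QuantumFields.BalabanUV.Beta.EriceRemainderEnclosureHistoryAutonomyComparisonAgeCompositionStaticChainHyperbolic (thetabar_mem_unit_interval)
open Literature.MathematicalPhysics.QuantumFieldTheory.Balaban1983to89.B7Eq38Remainder (exp_le_quartic)

/-! ## §1 The two-moment envelope `θ̄(r) ≤ 2∕r − (6∕5)∕r²` -/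

/-- `1∕(1 + x + x²∕2 + x³∕6 + 5x⁴∕96) ≤ e^{−x}` for `0 ≤ x ≤ 1` — from `e^x ≤ 1 + x + x²∕2 + x³∕6 + 5x⁴∕96` (the tree's `B7Eq38Remainder.exp_le_quartic`,
Mathlib's `Real.exp_bound'` with four terms). [folklore] -/
theorem inv_taylor_le_exp_neg {x : ℝ} (h0 : 0 ≤ x) (h1 : x ≤ 1) :
    1 / (1 + x + x ^ 2 / 2 + x ^ 3 / 6 + 5 * x ^ 4 / 96) ≤ Real.exp (-x) := by
  rw [Real.exp_neg, ← one_div]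
  exact one_div_le_one_div_of_le (Real.exp_pos x) (exp_le_quartic h0 h1)

/-- `1∕(1+t∕2) ≤ √(1∕(1+t))` for `t ≥ 0` (`√(1+t) ≤ 1 + t∕2`). [folklore] -/
theorem inv_le_sqrt_inv {t : ℝ} (ht : 0 ≤ t) : 1 / (1 + t / 2) ≤ Real.sqrt (1 / (1 + t)) := by
  have h1 : 0 < 1 + t / 2 := by linarith
  have hsq : Real.sqrt (1 + t) ≤ 1 + t / 2 := by
    rw [Real.sqrt_le_left h1.le]
    nlinarith
  rw [Real.sqrt_div' _ (by linarith : (0:ℝ) ≤ 1 + t), Real.sqrt_one]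
  exact one_div_le_one_div_of_le (Real.sqrt_pos.mpr (by linarith)) hsq

/-- **THE POLYNOMIAL CERTIFICATE.**  For `0 ≤ t ≤ 1`:
`(1 − 2t + (6∕5)t²)·(1+t)·(1+t∕2)·(1 + t∕2 + t²∕8 + t³∕48 + 5t⁴∕1536) ≤ 1` — indeed `1 −` the left side `= t²·Q(t)` with
`Q(t) = 57∕40 − (13∕120)t − (6377∕7680)t² − (1901∕5120)t³ − (1343∕15360)t⁴ − (29∕1920)t⁵ − (1∕512)t⁶`, every non-constant coefficient negative, so `Q(t) ≥ Q(1) =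
0.0105… > 0` on `[0,1]`. [folklore] -/
theorem envelope_poly_le_one {t : ℝ} (h0 : 0 ≤ t) (h1 : t ≤ 1) :
    (1 - 2 * t + 6 / 5 * t ^ 2) * (1 + t) * (1 + t / 2) * (1 + t / 2 + t ^ 2 / 8 + t ^ 3 / 48 + 5 * t ^ 4 / 1536) ≤ 1 := by
  have hid : (1 - 2 * t + 6 / 5 * t ^ 2) * (1 + t) * (1 + t / 2) * (1 + t / 2 + t ^ 2 / 8 + t ^ 3 / 48 + 5 * t ^ 4 / 1536) =
      1 - t ^ 2 * (57 / 40 - 13 / 120 * t - 6377 / 7680 * t ^ 2 - 1901 / 5120 * t ^ 3 - 1343 / 15360 * t ^ 4 - 29 / 1920 * t ^ 5 - 1 / 512 * t ^ 6) := by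
    ring
  rw [hid]
  have ht2 : t ^ 2 ≤ 1 := pow_le_one₀ h0 h1
  have ht3 : t ^ 3 ≤ 1 := pow_le_one₀ h0 h1
  have ht4 : t ^ 4 ≤ 1 := pow_le_one₀ h0 h1
  have ht5 : t ^ 5 ≤ 1 := pow_le_one₀ h0 h1
  have ht6 : t ^ 6 ≤ 1 := pow_le_one₀ h0 h1
  have hQ : 0 ≤ 57 / 40 - 13 / 120 * t - 6377 / 7680 * t ^ 2 - 1901 / 5120 * t ^ 3 - 1343 / 15360 * t ^ 4 - 29 / 1920 * t ^ 5 - 1 / 512 * t ^ 6 := by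
    linarith
  nlinarith [sq_nonneg t]

/-- **THE QUADRATIC LOWER ENVELOPE OF THE PERSISTENCE FACTOR**: `(1∕(1+t))·√(1∕(1+t))·e^{−t∕2} ≥ 1 − 2t + (6∕5)t²` for `0 ≤ t ≤ 1` (`e^{−t∕2} ≥ 1∕E(t∕2)`,
`√(1∕(1+t)) ≥ 1∕(1+t∕2)`, and the polynomial certificate).  The optimal quadratic through both ends has `2 − θ̄(1) = 1.2144…` in place of `6∕5` (numerics;
`ϑ(t)∕t` convex) — not claimed. [folklore] -/
theorem psi_ge_quadratic {t : ℝ} (h0 : 0 ≤ t) (h1 : t ≤ 1) :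
    1 - 2 * t + 6 / 5 * t ^ 2 ≤ 1 / (1 + t) * Real.sqrt (1 / (1 + t)) * Real.exp (-(t / 2)) := by
  have hp : 0 < 1 + t := by linarith
  have hE : 0 < 1 + t / 2 + t ^ 2 / 8 + t ^ 3 / 48 + 5 * t ^ 4 / 1536 := by positivity
  have hh : 0 < 1 + t / 2 := by linarith
  -- the three lower bounds
  have he : 1 / (1 + t / 2 + t ^ 2 / 8 + t ^ 3 / 48 + 5 * t ^ 4 / 1536) ≤ Real.exp (-(t / 2)) := by
    have := inv_taylor_le_exp_neg (x := t / 2) (by linarith) (by linarith)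
    have e : 1 + t / 2 + (t / 2) ^ 2 / 2 + (t / 2) ^ 3 / 6 + 5 * (t / 2) ^ 4 / 96 = 1 + t / 2 + t ^ 2 / 8 + t ^ 3 / 48 + 5 * t ^ 4 / 1536 := by ring
    rwa [e] at this
  have hs : 1 / (1 + t / 2) ≤ Real.sqrt (1 / (1 + t)) := inv_le_sqrt_inv h0
  have hprod : 1 / (1 + t) * (1 / (1 + t / 2)) * (1 / (1 + t / 2 + t ^ 2 / 8 + t ^ 3 / 48 + 5 * t ^ 4 / 1536)) ≤
      1 / (1 + t) * Real.sqrt (1 / (1 + t)) * Real.exp (-(t / 2)) :=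
    mul_le_mul (mul_le_mul_of_nonneg_left hs (by positivity)) he (by positivity) (mul_nonneg (by positivity) (Real.sqrt_nonneg _))
  refine le_trans ?_ hprod
  -- polynomial certificate
  rw [show 1 / (1 + t) * (1 / (1 + t / 2)) * (1 / (1 + t / 2 + t ^ 2 / 8 + t ^ 3 / 48 + 5 * t ^ 4 / 1536)) =
      1 / ((1 + t) * (1 + t / 2) * (1 + t / 2 + t ^ 2 / 8 + t ^ 3 / 48 + 5 * t ^ 4 / 1536)) by field_simp,
    le_div_iff₀ (by positivity)]
  have := envelope_poly_le_one h0 h1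
  nlinarith

/-- **THE TWO-MOMENT ENVELOPE OF THE UNIVERSAL DEFECT** in (E72c)'s letters: for every scale ratio `r ≥ 1`,
`θ̄(r) = 1 − r∕(r+1)·√(r∕(r+1))·e^{−1∕(2r)} ≤ 2∕r − (6∕5)∕r²` — i.e. with `t = 1∕r`: `θ̄ ≤ 2t − (6∕5)t²`, a quadratic in the scaled position `t = z∕a` of the old
age `a` seen from the young scale `z`, exact as `r → ∞` (`θ̄ = 2∕r − 2.75∕r² + …`) and `0.8` at `r = 1` (`θ̄(1) = 0.7856`). [folklore] -/
theorem thetabar_le_two_moment {r : ℝ} (hr : 1 ≤ r) :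
    1 - r / (r + 1) * Real.sqrt (r / (r + 1)) * Real.exp (-(1 / (2 * r))) ≤ 2 / r - 6 / 5 / r ^ 2 := by
  have hr0 : 0 < r := by linarith
  have h := psi_ge_quadratic (t := 1 / r) (by positivity) ((div_le_one hr0).mpr hr)
  have e1 : 1 / (1 + 1 / r) = r / (r + 1) := by field_simp
  have e2 : -(1 / r / 2) = -(1 / (2 * r)) := by ring
  rw [e1, e2] at h
  have e3 : 2 / r - 6 / 5 / r ^ 2 = 1 - (1 - 2 * (1 / r) + 6 / 5 * (1 / r) ^ 2) := by field_simp; ring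
  rw [e3]
  linarith

/-- The same with the two ages displayed: an old age `a > 0` seen from a young scale `0 < z ≤ a` has `θ̄(a∕z) ≤ 2(z∕a) − (6∕5)(z∕a)²`. [folklore] -/
theorem thetabar_le_two_moment_ages {a z : ℝ} (hz : 0 < z) (hza : z ≤ a) :
    1 - (a / z) / (a / z + 1) * Real.sqrt ((a / z) / (a / z + 1)) * Real.exp (-(1 / (2 * (a / z)))) ≤ 2 * (z / a) - 6 / 5 * (z / a) ^ 2 := by
  have ha : 0 < a := lt_of_lt_of_le hz hza
  have h := thetabar_le_two_moment (r := a / z) ((one_le_div hz).mpr hza)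
  have e : 2 / (a / z) - 6 / 5 / (a / z) ^ 2 = 2 * (z / a) - 6 / 5 * (z / a) ^ 2 := by field_simp
  linarith [e.le, e.ge]

/-! ## §2 Exact moment bookkeeping of the static chain -/

/-- **MOMENT UPDATE.**  Under the static chain's update ((E72a): `b_{m+1,i} = b_{m,i}∕(1−ρ_m)` for `i < m`, `b_{m+1,m} = ρ_m∕(1−ρ_m)`), EVERY weighted sum of the
carried ratios updates as `Σ_{i<m+1} w_i·b_{m+1,i} = (Σ_{i<m} w_i·b_{m,i} + w_m·ρ_m)∕(1 − ρ_m)` — in particular the moments `m_p(z) = Σ_i (z∕a_i)^p·b_i` for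
every young scale `z` and every order `p`. [folklore] -/
theorem moment_succ {ρ : ℕ → ℝ} {b : ℕ → ℕ → ℝ}
    (hnew : ∀ m, b (m + 1) m = ρ m / (1 - ρ m)) (hold : ∀ m i, i < m → b (m + 1) i = b m i / (1 - ρ m))
    (w : ℕ → ℝ) (m : ℕ) :
    ∑ i ∈ range (m + 1), w i * b (m + 1) i = (∑ i ∈ range m, w i * b m i + w m * ρ m) / (1 - ρ m) := by
  rw [sum_range_succ, hnew, add_div, sum_div]
  congr 1
  · exact sum_congr rfl fun i hi => by rw [hold m i (mem_range.mp hi)]; ring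
  · ring

/-- **MOMENT RESCALING.**  The moments seen from two young scales `z, z'` (`z ≠ 0`) differ by the exact factor `(z'∕z)^p`:
`Σ_i (z'∕a_i)^p·b_i = (z'∕z)^p·Σ_i (z∕a_i)^p·b_i`. [folklore] -/
theorem moment_rescale (a : ℕ → ℝ) (b : ℕ → ℝ) {z : ℝ} (hz : z ≠ 0) (z' : ℝ) (p n : ℕ) :
    ∑ i ∈ range n, (z' / a i) ^ p * b i = (z' / z) ^ p * ∑ i ∈ range n, (z / a i) ^ p * b i := by
  rw [mul_sum]
  refine sum_congr rfl fun i _ => ?_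
  rw [← mul_assoc, ← mul_pow]
  congr 2
  field_simp

/-- The two-moment defects give the two-moment load: `Σ_i (2t_i − (6∕5)t_i²)·b_i = 2·m₁ − (6∕5)·m₂`. [folklore] -/
theorem two_moment_load_eq (t b : ℕ → ℝ) (n : ℕ) :
    ∑ i ∈ range n, (2 * t i - 6 / 5 * t i ^ 2) * b i = 2 * ∑ i ∈ range n, t i * b i - 6 / 5 * ∑ i ∈ range n, t i ^ 2 * b i := by
  rw [mul_sum, mul_sum, ← sum_sub_distrib]
  exact sum_congr rfl fun i _ => by ring

/-! ## §3 The two-moment majorant of the static chain -/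

/-- **THE TWO-MOMENT ENVELOPE OF THE CHAIN LOAD.**  Ages `a_i > 0` processed oldest first (`a_m ≤ a_i` for `i < m`), carried ratios `b_{m,i} ≥ 0`: the load the
young age `a_m` sees through the universal defects is below the two-moment combination,
`Σ_{i<m} θ̄(a_i∕a_m)·b_{m,i} ≤ 2·Σ_{i<m} (a_m∕a_i)·b_{m,i} − (6∕5)·Σ_{i<m} (a_m∕a_i)²·b_{m,i}`. [folklore] -/
theorem load_le_two_moment {a : ℕ → ℝ} {b : ℕ → ℕ → ℝ} (ha : ∀ i, 0 < a i) {m : ℕ} (hord : ∀ i, i < m → a m ≤ a i)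
    (hb : ∀ i, i < m → 0 ≤ b m i) :
    ∑ i ∈ range m, (1 - (a i / a m) / (a i / a m + 1) * Real.sqrt ((a i / a m) / (a i / a m + 1)) * Real.exp (-(1 / (2 * (a i / a m))))) * b m i ≤
      2 * ∑ i ∈ range m, (a m / a i) * b m i - 6 / 5 * ∑ i ∈ range m, (a m / a i) ^ 2 * b m i := by
  rw [← two_moment_load_eq]
  exact sum_le_sum fun i hi =>
    mul_le_mul_of_nonneg_right (thetabar_le_two_moment_ages (ha m) (hord i (mem_range.mp hi))) (hb i (mem_range.mp hi))

/-- **THE TWO-MOMENT CHAIN IS A MAJORANT CHAIN.**  The static chain with universal defects `θ_{m,i} = θ̄(a_i∕a_m)` (ages processed oldest first), loads `x ≥ 0`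
and window masses `Ω' < 1`, and the chain with the SAME loads and window masses but the quadratic defects `θ'_{m,i} = 2(a_m∕a_i) − (6∕5)(a_m∕a_i)²` — whose
load is the two-moment combination `2m₁ − (6∕5)m₂` of §2, an exact three-number state under rescaling and update —: if the two-moment chain closes on the
first `M` steps, so does the static chain, with `0 ≤ ρ_m ≤ ρ'_m < 1` ((E72a) `ratio_le_of_majorant`). [folklore] -/
theorem closes_of_two_moment_chain_closes {a x Ω ρ ρ' : ℕ → ℝ} {b b' : ℕ → ℕ → ℝ} (ha : ∀ i, 0 < a i) (hanti : ∀ i j, i ≤ j → a j ≤ a i)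
    (hρ : ∀ m, ρ m = x m * (1 + ∑ i ∈ range m,
      (1 - (a i / a m) / (a i / a m + 1) * Real.sqrt ((a i / a m) / (a i / a m + 1)) * Real.exp (-(1 / (2 * (a i / a m))))) * b m i) / (1 - Ω m))
    (hρ' : ∀ m, ρ' m = x m * (1 + ∑ i ∈ range m, (2 * (a m / a i) - 6 / 5 * (a m / a i) ^ 2) * b' m i) / (1 - Ω m))
    (hnew : ∀ m, b (m + 1) m = ρ m / (1 - ρ m)) (hold : ∀ m i, i < m → b (m + 1) i = b m i / (1 - ρ m))
    (hnew' : ∀ m, b' (m + 1) m = ρ' m / (1 - ρ' m)) (hold' : ∀ m i, i < m → b' (m + 1) i = b' m i / (1 - ρ' m))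
    (hx : ∀ m, 0 ≤ x m) (hΩ : ∀ m, Ω m < 1) {M : ℕ} (hclose : ∀ m, m < M → ρ' m < 1) :
    ∀ m, m < M → 0 ≤ ρ m ∧ ρ m ≤ ρ' m ∧ ρ m < 1 := by
  -- the majorant principle compares the defects at EVERY pair `(m, i)`; the chains only read `i < m`, so we guard the quadratic defect by `i < m`
  have hρ'' : ∀ m, ρ' m = x m * (1 + ∑ i ∈ range m, (if i < m then 2 * (a m / a i) - 6 / 5 * (a m / a i) ^ 2 else
      1 - (a i / a m) / (a i / a m + 1) * Real.sqrt ((a i / a m) / (a i / a m + 1)) * Real.exp (-(1 / (2 * (a i / a m))))) * b' m i) / (1 - Ω m) := by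
    intro m
    have hs : ∑ i ∈ range m, (if i < m then 2 * (a m / a i) - 6 / 5 * (a m / a i) ^ 2 else
        1 - (a i / a m) / (a i / a m + 1) * Real.sqrt ((a i / a m) / (a i / a m + 1)) * Real.exp (-(1 / (2 * (a i / a m))))) * b' m i =
        ∑ i ∈ range m, (2 * (a m / a i) - 6 / 5 * (a m / a i) ^ 2) * b' m i :=
      sum_congr rfl fun i hi => by rw [if_pos (mem_range.mp hi)]
    rw [hs, hρ' m]
  refine ratio_le_of_majorant hρ hρ'' hnew hold hnew' hold' (fun m => ⟨hx m, le_rfl⟩) (fun m i => ?_) (fun m => ⟨le_rfl, hΩ m⟩) hclose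
  have h0 := (thetabar_mem_unit_interval (div_pos (ha i) (ha m))).1
  by_cases him : i < m
  · rw [if_pos him]
    exact ⟨h0, thetabar_le_two_moment_ages (ha m) (hanti i m him.le)⟩
  · rw [if_neg him]
    exact ⟨h0, le_rfl⟩

/-! ## §4 The chord is rigorous: `θ̄(r) ≤ 2∕r − (2 − θ̄(1))∕r²` (exact at `r = 1` and `r → ∞`) -/

/-- Numerical enclosure of the persistence factor at ratio one, `ψ₁ = ½·√½·e^{−½} = 1 − θ̄(1)` (`= 0.21444…`): `0.2143 ≤ ψ₁ ≤ 0.2145` — from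
`0.7071 ≤ √½ ≤ 0.707107`, `1536∕2533 ≤ e^{−½}` (`inv_taylor_le_exp_neg`) and `e^{½} ≥ 211∕128` (five Taylor terms). [folklore] -/
theorem psi_one_bounds :
    (2143 : ℝ) / 10000 ≤ 1 / (1 + 1) * Real.sqrt (1 / (1 + 1)) * Real.exp (-(1 / (2 * 1))) ∧
      1 / (1 + 1) * Real.sqrt (1 / (1 + 1)) * Real.exp (-(1 / (2 * 1))) ≤ 2145 / 10000 := by
  have hs_lo : (7071 : ℝ) / 10000 ≤ Real.sqrt (1 / (1 + 1)) := Real.le_sqrt_of_sq_le (by norm_num)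
  have hs_hi : Real.sqrt (1 / (1 + 1)) ≤ (707107 : ℝ) / 1000000 := by
    rw [Real.sqrt_le_left (by norm_num)]; norm_num
  have he_lo : (1536 : ℝ) / 2533 ≤ Real.exp (-(1 / (2 * 1))) := by
    have h := inv_taylor_le_exp_neg (x := (1 : ℝ) / 2) (by norm_num) (by norm_num)
    have e : -(1 / (2 * 1) : ℝ) = -(1 / 2) := by norm_num
    rw [e]; refine le_trans (le_of_eq ?_) h; norm_num
  have he_hi : Real.exp (-(1 / (2 * 1))) ≤ (128 : ℝ) / 211 := by
    have h := Real.sum_le_exp_of_nonneg (x := (1 : ℝ) / 2) (by norm_num) 5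
    have hs : ∑ i ∈ range 5, ((1 : ℝ) / 2) ^ i / (i.factorial : ℝ) = 211 / 128 := by
      simp [sum_range_succ, Nat.factorial]; norm_num
    rw [hs] at h
    rw [show -(1 / (2 * 1) : ℝ) = -(1 / 2) by norm_num, Real.exp_neg]
    calc (Real.exp (1 / 2))⁻¹ ≤ ((211 : ℝ) / 128)⁻¹ := by
          exact inv_anti₀ (by norm_num) h
      _ = 128 / 211 := by norm_num
  have hs0 : 0 ≤ Real.sqrt (1 / (1 + 1) : ℝ) := Real.sqrt_nonneg _
  have he0 : 0 ≤ Real.exp (-(1 / (2 * 1)) : ℝ) := (Real.exp_pos _).le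
  constructor
  · calc (2143 : ℝ) / 10000 ≤ 1 / (1 + 1) * (7071 / 10000) * (1536 / 2533) := by norm_num
      _ ≤ 1 / (1 + 1) * Real.sqrt (1 / (1 + 1)) * Real.exp (-(1 / (2 * 1))) :=
          mul_le_mul (mul_le_mul_of_nonneg_left hs_lo (by norm_num)) he_lo (by norm_num) (by positivity)
  · calc 1 / (1 + 1) * Real.sqrt (1 / (1 + 1)) * Real.exp (-(1 / (2 * 1)))
        ≤ 1 / (1 + 1) * (707107 / 1000000) * ((128 : ℝ) / 211) :=
          mul_le_mul (mul_le_mul_of_nonneg_left hs_hi (by norm_num)) he_hi he0 (by positivity)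
      _ ≤ 2145 / 10000 := by norm_num

/-- The persistence factor is non-increasing on `[0,1]` towards `t = 1`: `ψ(t) = (1∕(1+t))·√(1∕(1+t))·e^{−t∕2} ≥ ψ(1)` for `0 ≤ t ≤ 1` (each factor is). [folklore] -/
theorem psi_ge_psi_one {t : ℝ} (h0 : 0 ≤ t) (h1 : t ≤ 1) :
    1 / (1 + 1) * Real.sqrt (1 / (1 + 1)) * Real.exp (-(1 / (2 * 1))) ≤ 1 / (1 + t) * Real.sqrt (1 / (1 + t)) * Real.exp (-(t / 2)) := by
  have hf1 : (1 : ℝ) / (1 + 1) ≤ 1 / (1 + t) := one_div_le_one_div_of_le (by linarith) (by linarith)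
  have hf2 : Real.sqrt (1 / (1 + 1)) ≤ Real.sqrt (1 / (1 + t)) := Real.sqrt_le_sqrt hf1
  have hf3 : Real.exp (-(1 / (2 * 1))) ≤ Real.exp (-(t / 2)) := Real.exp_le_exp.mpr (by linarith)
  exact mul_le_mul (mul_le_mul hf1 hf2 (Real.sqrt_nonneg _) (by positivity)) hf3 (Real.exp_pos _).le
    (mul_nonneg (by positivity) (Real.sqrt_nonneg _))

/-- **THE CHORD, LEFT PIECE** (`0 ≤ t ≤ 9∕10`): `(1−t)² + ψ₁t² ≤ ψ(t)` — the lower envelope `ψ ≥ 1∕((1+t)(1+t∕2)E(t∕2))` of `psi_ge_quadratic` and the polynomial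
certificate with `ψ₁ ≤ 0.2145`: `1 − [(1−t)² + 0.2145t²](1+t)(1+t∕2)E(t∕2) = t²Q(t)`, `Q` decreasing on `[0,1]`, `Q(9∕10) = 0.254 > 0`. [folklore] -/
theorem psi_ge_chord_left {t : ℝ} (h0 : 0 ≤ t) (h1 : t ≤ 9 / 10) :
    (1 - t) ^ 2 + 1 / (1 + 1) * Real.sqrt (1 / (1 + 1)) * Real.exp (-(1 / (2 * 1))) * t ^ 2 ≤
      1 / (1 + t) * Real.sqrt (1 / (1 + t)) * Real.exp (-(t / 2)) := by
  obtain ⟨_, hψhi⟩ := psi_one_bounds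
  set ψ₁ := (1 : ℝ) / (1 + 1) * Real.sqrt (1 / (1 + 1)) * Real.exp (-(1 / (2 * 1))) with hψ₁
  have hp : 0 < 1 + t := by linarith
  have hE : 0 < 1 + t / 2 + t ^ 2 / 8 + t ^ 3 / 48 + 5 * t ^ 4 / 1536 := by positivity
  have hh : 0 < 1 + t / 2 := by linarith
  -- the lower envelope of ψ (as in `psi_ge_quadratic`)
  have he : 1 / (1 + t / 2 + t ^ 2 / 8 + t ^ 3 / 48 + 5 * t ^ 4 / 1536) ≤ Real.exp (-(t / 2)) := by
    have := inv_taylor_le_exp_neg (x := t / 2) (by linarith) (by linarith)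
    have e : 1 + t / 2 + (t / 2) ^ 2 / 2 + (t / 2) ^ 3 / 6 + 5 * (t / 2) ^ 4 / 96 = 1 + t / 2 + t ^ 2 / 8 + t ^ 3 / 48 + 5 * t ^ 4 / 1536 := by ring
    rwa [e] at this
  have hs : 1 / (1 + t / 2) ≤ Real.sqrt (1 / (1 + t)) := inv_le_sqrt_inv h0
  have hprod : 1 / (1 + t) * (1 / (1 + t / 2)) * (1 / (1 + t / 2 + t ^ 2 / 8 + t ^ 3 / 48 + 5 * t ^ 4 / 1536)) ≤
      1 / (1 + t) * Real.sqrt (1 / (1 + t)) * Real.exp (-(t / 2)) :=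
    mul_le_mul (mul_le_mul_of_nonneg_left hs (by positivity)) he (by positivity) (mul_nonneg (by positivity) (Real.sqrt_nonneg _))
  refine le_trans ?_ hprod
  rw [show 1 / (1 + t) * (1 / (1 + t / 2)) * (1 / (1 + t / 2 + t ^ 2 / 8 + t ^ 3 / 48 + 5 * t ^ 4 / 1536)) =
      1 / ((1 + t) * (1 + t / 2) * (1 + t / 2 + t ^ 2 / 8 + t ^ 3 / 48 + 5 * t ^ 4 / 1536)) by field_simp,
    le_div_iff₀ (by positivity)]
  -- replace ψ₁ by its upper bound 0.2145 (the product is increasing in ψ₁)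
  have hP1 : 0 ≤ t ^ 2 * ((1 + t) * (1 + t / 2) * (1 + t / 2 + t ^ 2 / 8 + t ^ 3 / 48 + 5 * t ^ 4 / 1536)) := by positivity
  have hmono : ((1 - t) ^ 2 + ψ₁ * t ^ 2) * ((1 + t) * (1 + t / 2) * (1 + t / 2 + t ^ 2 / 8 + t ^ 3 / 48 + 5 * t ^ 4 / 1536)) ≤
      ((1 - t) ^ 2 + 2145 / 10000 * t ^ 2) * ((1 + t) * (1 + t / 2) * (1 + t / 2 + t ^ 2 / 8 + t ^ 3 / 48 + 5 * t ^ 4 / 1536)) := by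
    nlinarith [mul_le_mul_of_nonneg_right hψhi hP1]
  refine le_trans hmono ?_
  -- the certificate: 1 − P(t) = t²·Q(t), Q decreasing on [0,1], Q(9/10) > 0
  have hid : ((1 - t) ^ 2 + 2145 / 10000 * t ^ 2) * ((1 + t) * (1 + t / 2) * (1 + t / 2 + t ^ 2 / 8 + t ^ 3 / 48 + 5 * t ^ 4 / 1536)) =
      1 - t ^ 2 * (2821 / 2000 - 103 / 750 * t - 163253 / 192000 * t ^ 2 - 145127 / 384000 * t ^ 3 - 272921 / 3072000 * t ^ 4
        - 94163 / 6144000 * t ^ 5 - 2429 / 1228800 * t ^ 6) := by ring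
  rw [hid]
  have ht1 : t ≤ 9 / 10 := h1
  have ht2 : t ^ 2 ≤ (9 / 10) ^ 2 := pow_le_pow_left₀ h0 ht1 2
  have ht3 : t ^ 3 ≤ (9 / 10) ^ 3 := pow_le_pow_left₀ h0 ht1 3
  have ht4 : t ^ 4 ≤ (9 / 10) ^ 4 := pow_le_pow_left₀ h0 ht1 4
  have ht5 : t ^ 5 ≤ (9 / 10) ^ 5 := pow_le_pow_left₀ h0 ht1 5
  have ht6 : t ^ 6 ≤ (9 / 10) ^ 6 := pow_le_pow_left₀ h0 ht1 6
  have hQ : 0 ≤ 2821 / 2000 - 103 / 750 * t - 163253 / 192000 * t ^ 2 - 145127 / 384000 * t ^ 3 - 272921 / 3072000 * t ^ 4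
      - 94163 / 6144000 * t ^ 5 - 2429 / 1228800 * t ^ 6 := by
    nlinarith
  nlinarith [sq_nonneg t]

/-- **THE CHORD, RIGHT PIECE** (`7∕10 ≤ t ≤ 1`): `(1−t)² + ψ₁t² ≤ ψ₁ ≤ ψ(t)` — `(1−t) ≤ ψ₁(1+t)` there (`ψ₁ ≥ 0.2143 > 3∕17`) and `ψ` is non-increasing. [folklore] -/
theorem psi_ge_chord_right {t : ℝ} (h0 : 7 / 10 ≤ t) (h1 : t ≤ 1) :
    (1 - t) ^ 2 + 1 / (1 + 1) * Real.sqrt (1 / (1 + 1)) * Real.exp (-(1 / (2 * 1))) * t ^ 2 ≤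
      1 / (1 + t) * Real.sqrt (1 / (1 + t)) * Real.exp (-(t / 2)) := by
  obtain ⟨hψlo, _⟩ := psi_one_bounds
  have hψ := psi_ge_psi_one (by linarith) h1
  -- (1−t)² + ψ₁ t² ≤ ψ₁  ⟺  (1−t)·[(1−t) − ψ₁(1+t)] ≤ 0
  nlinarith [mul_nonneg (sub_nonneg.mpr h1) (by linarith : (0:ℝ) ≤ t - 7 / 10)]

/-- **THE CHORD OF THE UNIVERSAL DEFECT IS A RIGOROUS MAJORANT**: `ψ(t) ≥ (1−t)² + ψ(1)·t²` on `[0,1]`, i.e. `ϑ(t) = 1 − ψ(t) ≤ 2t − (1 + ψ(1))t² =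
2t − (2 − θ̄(1))t²` — the two-moment envelope with the OPTIMAL constant (`2 − θ̄(1) = 1.2144…`), EXACT at `t = 1` (ratio one: dense blocks, the pure spike) and at
`t → 0` (far ages).  (`ϑ(t)∕t` is in fact convex — README g66∕e75 §3; not needed here.) [folklore] -/
theorem psi_ge_chord {t : ℝ} (h0 : 0 ≤ t) (h1 : t ≤ 1) :
    (1 - t) ^ 2 + 1 / (1 + 1) * Real.sqrt (1 / (1 + 1)) * Real.exp (-(1 / (2 * 1))) * t ^ 2 ≤
      1 / (1 + t) * Real.sqrt (1 / (1 + t)) * Real.exp (-(t / 2)) := by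
  by_cases h : t ≤ 9 / 10
  · exact psi_ge_chord_left h0 h
  · exact psi_ge_chord_right (by linarith) h1

/-- **`θ̄(r) ≤ 2∕r − (2 − θ̄(1))∕r²` for every `r ≥ 1`** ((E72c)'s letters; `θ̄(1) = 1 − ½·√½·e^{−½}`): the chord envelope of §1 with its optimal constant.  With (E72a)
`ratio_le_of_majorant` exactly as in `closes_of_two_moment_chain_closes` (replace `6∕5` by `2 − θ̄(1)`). [folklore] -/
theorem thetabar_le_chord {r : ℝ} (hr : 1 ≤ r) :
    1 - r / (r + 1) * Real.sqrt (r / (r + 1)) * Real.exp (-(1 / (2 * r))) ≤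
      2 / r - (2 - (1 - 1 / (1 + 1) * Real.sqrt (1 / (1 + 1)) * Real.exp (-(1 / (2 * 1))))) / r ^ 2 := by
  have hr0 : 0 < r := by linarith
  have h := psi_ge_chord (t := 1 / r) (by positivity) ((div_le_one hr0).mpr hr)
  have e1 : 1 / (1 + 1 / r) = r / (r + 1) := by field_simp
  have e2 : -(1 / r / 2) = -(1 / (2 * r)) := by ring
  rw [e1, e2] at h
  set ψ₁ := (1 : ℝ) / (1 + 1) * Real.sqrt (1 / (1 + 1)) * Real.exp (-(1 / (2 * 1)))
  have e3 : 2 / r - (2 - (1 - ψ₁)) / r ^ 2 = 1 - ((1 - 1 / r) ^ 2 + ψ₁ * (1 / r) ^ 2) := by field_simp; ring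
  rw [e3]
  linarith

end Summit.QuantumFields.BalabanUV.Beta.EriceRemainderEnclosureHistoryAutonomyComparisonAgeCompositionStaticChainMoments

end
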